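import Literature.Topology.FourManifolds.FlatDiscMeridianLongitude
import HarnessLib

/-!
# `π₁` of the complement of the flat plane of a topologically flat slice disc

Topic `Literature/Topology/FourManifolds`; sibling (theorems only) of `FlatDiscMeridianLongitude.lean`,
for the topological half of the Fox–Milnor programme (the named fact
`Literature.Topology.FourManifolds.exists_eq_mul_invert_of_isTopologicallySlice`, `SliceKnots.lean`).
There, for the product neighbourhood `F` of a flat slice disc of a knot `K`, the radial extension
`radialExt F : ℝ² × ℝ² ↪ ℝ⁴` completes the disc to a closed flat plane `P ⊆ ℝ⁴` and
`H₁(ℝ⁴ ∖ P; ℤ) = ℤ · h(meridian)` (`exists_eq_zsmul_loopClass_planeMeridian`,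
`zsmul_loopClass_planeMeridian_injective`). Here we pass to `π₁`, as needed by the infinite cyclic
cover of the four-dimensional exterior (`InfiniteCyclicCover.lean`, `AlexanderModuleCover.lean`:
hypotheses `hker`, `e'`, `he'` of `alexanderModuleEquiv`):

* `TopFlatDisc.abelianization_mem_zpowers_of_loopClass`, `lift_windingHom_bijective`,
  `ker_windingHom_eq_commutator_of_loopClass`, `exists_mulEquiv_inv_windingHom_of_loopClass` —
  general: if the Hurewicz class of a loop `μ` generates `H₁(X; ℤ)` (`X` path connected) then `[μ]ᵃᵇ`
  generates `π₁(X, x₀)ᵃᵇ` (Hurewicz injective on `π₁ᵃᵇ`, Hatcher Thm. 2A.1, `HurewiczProofs.lean`),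
  and for a circle-valued map `f` along which `μ` winds `±1` times, `f̄_* : π₁ᵃᵇ → ℤ` is bijective,
  `ker f_* = [π₁, π₁]` and `[g] ↦ (f_* g)⁻¹` is an isomorphism `π₁ᵃᵇ ≃* ℤ` (the pattern of
  `KnotWindingHypotheses.lean`);
* `TopFlatDisc.isPathConnected_mvU`, `pathConnectedSpace_planeCompl` — **`ℝ⁴ ∖ P` is path connected**
  (`ℝ⁴ = (ℝ⁴ ∖ P) ∪ N` with the punctured neighbourhood `(ℝ⁴ ∖ P) ∩ N ≅ ℝ² × (ℂ ∖ 0)` connected;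
  `IsPreconnected.of_isOpen_cover`);
* `TopFlatDisc.abelianization_mem_zpowers_planeMeridian`, `zpow_abelianization_planeMeridian_injective`
  — **`π₁(ℝ⁴ ∖ P)ᵃᵇ` is infinite cyclic generated by the plane meridian**;
* `TopFlatDisc.ker_windingHom_eq_commutator_planeCompl`, `exists_mulEquiv_inv_windingHom_planeCompl` —
  the winding hypotheses for circle-valued maps on `ℝ⁴ ∖ P` along which the meridian winds `±1` times;
* `TopFlatDisc.exists_circleMap_winding_planeMeridian` — **a circle-valued map `θ : ℝ⁴ ∖ P → S¹` along
  which the meridian winds once** (Hatcher Prop. 1B.9, in the tree as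
  `exists_contMDiff_circleMap_realising`, applied to `π₁ → H₁ = ℤ · h(meridian) → ℤ`): the circle map /
  infinite cyclic cover of the flat-disc exterior (Livingston 2005, §2, proof of Thm. 2.6);
* `TopFlatDisc.exists_circleMap_winding_meridian_longitude` — its restriction to `S³ ∖ K` winds once
  along the meridian and zero times along the longitude of the flat tube.

Everything is proved; no definitions, no named facts.

## References

* A. Hatcher, *Algebraic Topology*, CUP 2002, Thm. 2A.1 (Hurewicz), §1.1 Thm. 1.7. [HatcherAT2002]
* D. Rolfsen, *Knots and Links* (1976), §7.A (the infinite cyclic cover of a knot / disc exterior).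
  [Rolfsen1976]
* C. Livingston, *A survey of classical knot concordance* (2005), §2 Thm. 2.6, §6. [Livingston2005]
-/

noncomputable section

open Set Function Metric Filter Topology CategoryTheory Limits
open Literature.AlgebraicTopology.SingularHomology
open Literature.AlgebraicTopology.FundamentalGroup.PuncturedPlane

namespace Literature.Topology.FourManifolds

namespace TopFlatDisc

variable {F : EuclideanSpace ℝ (Fin 2) × EuclideanSpace ℝ (Fin 2) → EuclideanSpace ℝ (Fin 4)}

/-! ### `π₁` of the plane complement and its winding hypotheses -/

section General

variable {X : Type} [TopologicalSpace X] {x₀ : X} (μ : Path x₀ x₀)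

/-- **A loop whose Hurewicz class generates `H₁(X; ℤ)` generates `π₁(X, x₀)ᵃᵇ`** (Hurewicz,
Hatcher Thm. 2A.1: `π₁ᵃᵇ → H₁` is injective for path-connected `X`). [cite: HatcherAT2002, Thm. 2A.1] -/
theorem abelianization_mem_zpowers_of_loopClass [PathConnectedSpace X]
    (hgen : ∀ c : singularHomology ℤ ℤ X 1, ∃ k : ℤ, c = k • loopClass ℤ ℤ (1 : ℤ) μ)
    (g : Abelianization (FundamentalGroup X x₀)) :
    g ∈ Subgroup.zpowers (Abelianization.of (FundamentalGroup.fromPath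
      (Path.Homotopic.Quotient.mk μ))) := by
  have hinj := HurewiczProof.hurewiczOneAb_injective x₀
  obtain ⟨k, hk⟩ := hgen (Multiplicative.toAdd (hurewiczOneAb ℤ ℤ (1 : ℤ) _ g))
  refine Subgroup.mem_zpowers_iff.2 ⟨k, hinj ?_⟩
  rw [map_zpow, hurewiczOneAb_of_fromPath]
  apply Multiplicative.toAdd.injective
  rw [toAdd_zpow, toAdd_ofAdd, ← hk]

/-- **If `H₁(X; ℤ) = ℤ · h(μ)` with `h(μ)` of infinite order and `μ` winds `±1` times along `f`, then
`f̄_* : π₁(X, x₀)ᵃᵇ → ℤ` is bijective.** [folklore] -/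
theorem lift_windingHom_bijective [PathConnectedSpace X] (f : C(X, Circle))
    (hgen : ∀ c : singularHomology ℤ ℤ X 1, ∃ k : ℤ, c = k • loopClass ℤ ℤ (1 : ℤ) μ)
    (h₀ : IsUnit (CircleMaps.winding f μ)) : Bijective (Abelianization.lift (CircleMaps.windingHom f x₀)) := by
  obtain ⟨u, hu⟩ := h₀
  have hzpow : ∀ n : ℤ, Abelianization.lift (CircleMaps.windingHom f x₀) (Abelianization.of
      (FundamentalGroup.fromPath (Path.Homotopic.Quotient.mk μ)) ^ n) = Multiplicative.ofAdd (n * CircleMaps.winding f μ) := by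
    intro n
    rw [map_zpow, Abelianization.lift_apply_of, CircleMaps.windingHom_fromPath, ← ofAdd_zsmul,
      smul_eq_mul]
  constructor
  · rw [← MonoidHom.ker_eq_bot_iff, eq_bot_iff]
    intro a ha
    rw [MonoidHom.mem_ker] at ha
    obtain ⟨n, hn⟩ := Subgroup.mem_zpowers_iff.1 (abelianization_mem_zpowers_of_loopClass μ hgen a)
    rw [← hn, hzpow] at ha
    have hn0 : n * CircleMaps.winding f μ = 0 := ofAdd_eq_one.1 ha
    rw [← hu] at hn0
    have hn' : n = 0 := by
      rcases Int.isUnit_iff.1 u.isUnit with h1 | h1 <;> rw [h1] at hn0 <;> omega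
    rw [← hn, hn', zpow_zero]
    exact Subgroup.mem_bot.2 rfl
  · intro z
    refine ⟨Abelianization.of (FundamentalGroup.fromPath (Path.Homotopic.Quotient.mk μ)) ^
      (Multiplicative.toAdd z * (u⁻¹ : ℤˣ)), ?_⟩
    rw [hzpow, ← hu, mul_assoc, Units.inv_mul, mul_one, ofAdd_toAdd]

/-- **Hypothesis `hker`**: under the same assumptions the kernel of the winding homomorphism is the
commutator subgroup. [folklore] -/
theorem ker_windingHom_eq_commutator_of_loopClass [PathConnectedSpace X] (f : C(X, Circle))
    (hgen : ∀ c : singularHomology ℤ ℤ X 1, ∃ k : ℤ, c = k • loopClass ℤ ℤ (1 : ℤ) μ)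
    (h₀ : IsUnit (CircleMaps.winding f μ)) :
    (CircleMaps.windingHom f x₀).ker = commutator (FundamentalGroup X x₀) := by
  rw [← Abelianization.ker_of]
  ext g
  rw [MonoidHom.mem_ker, MonoidHom.mem_ker,
    ← Abelianization.lift_apply_of (CircleMaps.windingHom f x₀) g]
  constructor
  · intro h
    exact (lift_windingHom_bijective μ f hgen h₀).1 (h.trans (map_one _).symm)
  · intro h
    rw [h, map_one]

/-- **Hypotheses `e'`, `he'`**: under the same assumptions `[g] ↦ (f_* g)⁻¹` is an isomorphism
`π₁(X, x₀)ᵃᵇ ≃* ℤ`. [folklore] -/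
theorem exists_mulEquiv_inv_windingHom_of_loopClass [PathConnectedSpace X] (f : C(X, Circle))
    (hgen : ∀ c : singularHomology ℤ ℤ X 1, ∃ k : ℤ, c = k • loopClass ℤ ℤ (1 : ℤ) μ)
    (h₀ : IsUnit (CircleMaps.winding f μ)) :
    ∃ e' : Abelianization (FundamentalGroup X x₀) ≃* Multiplicative ℤ,
      ∀ g, e' (Abelianization.of g) = (CircleMaps.windingHom f x₀ g)⁻¹ :=
  ⟨(MulEquiv.ofBijective _ (lift_windingHom_bijective μ f hgen h₀)).trans (MulEquiv.inv _),
    fun g => by simp⟩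

end General

section PlaneComplementPi1

variable (hemb : IsEmbedding ((Metric.closedBall (0 : EuclideanSpace ℝ (Fin 2)) 1 ×ˢ
  (univ : Set (EuclideanSpace ℝ (Fin 2)))).restrict F))
variable (hnorm : ∀ x w : EuclideanSpace ℝ (Fin 2),
  ‖x‖ ≤ 1 → ‖F (x, w)‖ ≤ 1 ∧ (‖F (x, w)‖ = 1 ↔ ‖x‖ = 1))
include hemb hnorm

/-- The punctured neighbourhood `(ℝ⁴ ∖ P) ∩ radialExt F (ℝ² × ℝ²) ≅ ℝ² × (ℂ ∖ 0)` is path connected.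
[folklore] -/
theorem isPathConnected_mvU_inter_mvV : IsPathConnected (mvU F ∩ mvV F) := by
  haveI := pathConnectedSpace_cStar
  rw [← range_puncturedMap hemb hnorm]
  exact isPathConnected_range (isEmbedding_puncturedMap hemb hnorm).continuous

/-- **The complement of the flat plane is path connected** (`ℝ⁴ = (ℝ⁴ ∖ P) ∪ N` with `N` and
`(ℝ⁴ ∖ P) ∩ N` connected). [folklore] -/
theorem isPathConnected_mvU : IsPathConnected (mvU F) := by
  have hpre : IsPreconnected (mvU F) := by
    refine IsPreconnected.of_isOpen_cover (isClosed_plane hemb hnorm).isOpen_compl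
      (isOpenEmbedding_radialExt hemb hnorm).isOpen_range ?_
      (isPathConnected_mvU_inter_mvV hemb hnorm).isConnected.isPreconnected
    refine eq_univ_of_forall fun y => ?_
    by_cases hy : y ∈ plane F
    · exact Or.inr (plane_subset_range hy)
    · exact Or.inl hy
  rw [← (isClosed_plane hemb hnorm).isOpen_compl.isConnected_iff_isPathConnected]
  obtain ⟨y, hy, -⟩ := (isPathConnected_mvU_inter_mvV hemb hnorm).nonempty
  exact ⟨⟨y, hy⟩, hpre⟩

/-- The complement of the flat plane, as a space, is path connected. [folklore] -/
theorem pathConnectedSpace_planeCompl : PathConnectedSpace ↥(mvU F) :=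
  isPathConnected_iff_pathConnectedSpace.1 (isPathConnected_mvU hemb hnorm)

/-- **`π₁(ℝ⁴ ∖ P)ᵃᵇ` is generated by the meridian of the plane.** [folklore] -/
theorem abelianization_mem_zpowers_planeMeridian (x₀ : EuclideanSpace ℝ (Fin 2)) (r : ℝ)
    (hr : 0 < r) (g : Abelianization (FundamentalGroup ↥(mvU F)
      (subsetInclusion (inter_subset_left : mvU F ∩ mvV F ⊆ mvU F)
        (puncturedHomeomorph hemb hnorm (x₀, bpt r hr))))) :
    g ∈ Subgroup.zpowers (Abelianization.of (FundamentalGroup.fromPath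
      (Path.Homotopic.Quotient.mk (planeMeridian hemb hnorm x₀ r hr)))) := by
  haveI := pathConnectedSpace_planeCompl hemb hnorm
  exact abelianization_mem_zpowers_of_loopClass _
    (exists_eq_zsmul_loopClass_planeMeridian hemb hnorm x₀ r hr) g

/-- **The meridian of the plane has infinite order in `π₁(ℝ⁴ ∖ P)ᵃᵇ`.** [folklore] -/
theorem zpow_abelianization_planeMeridian_injective (x₀ : EuclideanSpace ℝ (Fin 2)) (r : ℝ)
    (hr : 0 < r) :
    Function.Injective fun k : ℤ => (Abelianization.of (FundamentalGroup.fromPath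
      (Path.Homotopic.Quotient.mk (planeMeridian hemb hnorm x₀ r hr)))) ^ k :=
  zpow_abelianization_injective_of_loopClass ℤ ℤ 1 _
    (zsmul_loopClass_planeMeridian_injective hemb hnorm x₀ r hr)

/-- **Winding hypotheses for the plane complement**: if the plane meridian winds `±1` times along a
circle-valued map `f : ℝ⁴ ∖ P → S¹`, then `ker f_* = [π₁, π₁]` and `[g] ↦ (f_* g)⁻¹` is an
isomorphism `π₁(ℝ⁴ ∖ P)ᵃᵇ ≃* ℤ` (the hypotheses `hker`, `e'`, `he'` of the infinite cyclic cover
machinery, `AlexanderModuleCover.alexanderModuleEquiv`, for the four-dimensional exterior).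
[folklore] -/
theorem ker_windingHom_eq_commutator_planeCompl (f : C(↥(mvU F), Circle))
    (x₀ : EuclideanSpace ℝ (Fin 2)) (r : ℝ) (hr : 0 < r)
    (h₀ : IsUnit (CircleMaps.winding f (planeMeridian hemb hnorm x₀ r hr))) :
    (CircleMaps.windingHom f _).ker = commutator (FundamentalGroup ↥(mvU F)
      (subsetInclusion (inter_subset_left : mvU F ∩ mvV F ⊆ mvU F)
        (puncturedHomeomorph hemb hnorm (x₀, bpt r hr)))) := by
  haveI := pathConnectedSpace_planeCompl hemb hnorm
  exact ker_windingHom_eq_commutator_of_loopClass _ f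
    (exists_eq_zsmul_loopClass_planeMeridian hemb hnorm x₀ r hr) h₀

/-- **Winding hypotheses for the plane complement**, isomorphism form. [folklore] -/
theorem exists_mulEquiv_inv_windingHom_planeCompl (f : C(↥(mvU F), Circle))
    (x₀ : EuclideanSpace ℝ (Fin 2)) (r : ℝ) (hr : 0 < r)
    (h₀ : IsUnit (CircleMaps.winding f (planeMeridian hemb hnorm x₀ r hr))) :
    ∃ e' : Abelianization (FundamentalGroup ↥(mvU F)
        (subsetInclusion (inter_subset_left : mvU F ∩ mvV F ⊆ mvU F)
          (puncturedHomeomorph hemb hnorm (x₀, bpt r hr)))) ≃* Multiplicative ℤ,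
      ∀ g, e' (Abelianization.of g) = (CircleMaps.windingHom f _ g)⁻¹ := by
  haveI := pathConnectedSpace_planeCompl hemb hnorm
  exact exists_mulEquiv_inv_windingHom_of_loopClass _ f
    (exists_eq_zsmul_loopClass_planeMeridian hemb hnorm x₀ r hr) h₀

end PlaneComplementPi1

/-! ### A circle-valued map on the plane complement along which the meridian winds once -/

section CircleMap

variable (hemb : IsEmbedding ((Metric.closedBall (0 : EuclideanSpace ℝ (Fin 2)) 1 ×ˢ
  (univ : Set (EuclideanSpace ℝ (Fin 2)))).restrict F))
variable (hnorm : ∀ x w : EuclideanSpace ℝ (Fin 2),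
  ‖x‖ ≤ 1 → ‖F (x, w)‖ ≤ 1 ∧ (‖F (x, w)‖ = 1 ↔ ‖x‖ = 1))
include hemb hnorm

/-- **The coefficient of a class of `H₁(ℝ⁴ ∖ P; ℤ)` on the meridian**: an additive `c : H₁ → ℤ` with
`y = c(y) • h(meridian)` for all `y` and `c(h(meridian)) = 1`. [folklore] -/
theorem exists_addMonoidHom_eq_zsmul_loopClass_planeMeridian (x₀ : EuclideanSpace ℝ (Fin 2)) (r : ℝ)
    (hr : 0 < r) :
    ∃ c : singularHomology ℤ ℤ (mvU F) 1 →+ ℤ,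
      c (loopClass ℤ ℤ (1 : ℤ) (planeMeridian hemb hnorm x₀ r hr)) = 1 ∧
      ∀ y, y = c y • loopClass ℤ ℤ (1 : ℤ) (planeMeridian hemb hnorm x₀ r hr) := by
  set μ := loopClass ℤ ℤ (1 : ℤ) (planeMeridian hemb hnorm x₀ r hr) with hμ
  let f : ℤ →+ singularHomology ℤ ℤ (mvU F) 1 := zmultiplesHom _ μ
  have hf : ∀ k : ℤ, f k = k • μ := fun k => rfl
  have hbij : Function.Bijective f := by
    refine ⟨fun k l hkl => zsmul_loopClass_planeMeridian_injective hemb hnorm x₀ r hr hkl,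
      fun y => ?_⟩
    obtain ⟨k, hk⟩ := exists_eq_zsmul_loopClass_planeMeridian hemb hnorm x₀ r hr y
    exact ⟨k, hk.symm⟩
  let e : ℤ ≃+ singularHomology ℤ ℤ (mvU F) 1 := AddEquiv.ofBijective f hbij
  refine ⟨(e.symm : singularHomology ℤ ℤ (mvU F) 1 →+ ℤ), ?_, fun y => ?_⟩
  · change e.symm μ = 1
    rw [AddEquiv.symm_apply_eq]
    change μ = f 1
    rw [hf, one_zsmul]
  · change y = e.symm y • μ
    conv_lhs => rw [← e.apply_symm_apply y]
    exact hf _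

/-- **A circle-valued map on `ℝ⁴ ∖ P` along which the meridian winds once** (Hatcher Prop. 1B.9 for
`K(ℤ, 1) = S¹`, in the tree as `exists_contMDiff_circleMap_realising`, applied to the homomorphism
`π₁(ℝ⁴ ∖ P, z₀) → H₁(ℝ⁴ ∖ P; ℤ) = ℤ · h(meridian) → ℤ`): there is `θ : ℝ⁴ ∖ P → S¹` such that a loop
at the base point of the meridian with homology class `k · h(meridian)` winds `k` times along `θ`;
in particular the meridian winds once. This is the circle-valued map / infinite cyclic cover of the
flat-disc exterior of Livingston (2005), §2, proof of Thm. 2.6 ("obstruction theory … `B⁴ − D → S¹`").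
[cite: Livingston2005, §2 Thm. 2.6] [cite: HatcherAT2002, Prop. 1B.9] -/
theorem exists_circleMap_winding_planeMeridian (x₀ : EuclideanSpace ℝ (Fin 2)) (r : ℝ) (hr : 0 < r) :
    ∃ θ : C(↥(mvU F), Circle),
      CircleMaps.winding θ (planeMeridian hemb hnorm x₀ r hr) = 1 ∧
      ∀ (γ : Path (subsetInclusion (inter_subset_left : mvU F ∩ mvV F ⊆ mvU F)
          (puncturedHomeomorph hemb hnorm (x₀, bpt r hr)))
          (subsetInclusion (inter_subset_left : mvU F ∩ mvV F ⊆ mvU F)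
          (puncturedHomeomorph hemb hnorm (x₀, bpt r hr)))) (k : ℤ),
        loopClass ℤ ℤ (1 : ℤ) γ = k • loopClass ℤ ℤ (1 : ℤ) (planeMeridian hemb hnorm x₀ r hr) →
          CircleMaps.winding θ γ = k := by
  set z₀ := subsetInclusion (inter_subset_left : mvU F ∩ mvV F ⊆ mvU F)
    (puncturedHomeomorph hemb hnorm (x₀, bpt r hr)) with hz₀
  obtain ⟨c, hc1, hc⟩ := exists_addMonoidHom_eq_zsmul_loopClass_planeMeridian hemb hnorm x₀ r hr
  -- the homomorphism `π₁ → ℤ`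
  let φ : FundamentalGroup ↥(mvU F) z₀ →* Multiplicative ℤ :=
    (AddMonoidHom.toMultiplicative c).comp (hurewiczOne ℤ ℤ (1 : ℤ) z₀)
  have hφ : ∀ γ : Path z₀ z₀, Multiplicative.toAdd (φ (FundamentalGroup.fromPath
      (Path.Homotopic.Quotient.mk γ))) = c (loopClass ℤ ℤ (1 : ℤ) γ) := fun γ => rfl
  -- the open-submanifold structure of `ℝ⁴ ∖ P ⊆ ℝ⁴`
  let O : TopologicalSpace.Opens (EuclideanSpace ℝ (Fin 4)) :=
    ⟨(plane F)ᶜ, (isClosed_plane hemb hnorm).isOpen_compl⟩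
  letI : ChartedSpace (EuclideanSpace ℝ (Fin 4)) ↥(mvU F) :=
    show ChartedSpace (EuclideanSpace ℝ (Fin 4)) O from inferInstance
  haveI : IsManifold (modelWithCornersSelf ℝ (EuclideanSpace ℝ (Fin 4))) ⊤ ↥(mvU F) :=
    show IsManifold (modelWithCornersSelf ℝ (EuclideanSpace ℝ (Fin 4))) ⊤ O from inferInstance
  haveI : LocallyCompactSpace ↥(mvU F) := (isClosed_plane hemb hnorm).isOpen_compl.locallyCompactSpace
  haveI : PathConnectedSpace ↥(mvU F) := pathConnectedSpace_planeCompl hemb hnorm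
  obtain ⟨θ, hθs, hθ⟩ := exists_contMDiff_circleMap_realising (E := EuclideanSpace ℝ (Fin 4))
    (N := ↥(mvU F)) z₀ φ
  have htc : Continuous toCircle :=
    (contDiff_toC.continuous.comp continuous_subtype_val).subtype_mk _
  let θC : C(↥(mvU F), Circle) := ⟨fun y => toCircle (θ y), htc.comp hθs.continuous⟩
  have hwind : ∀ γ : Path z₀ z₀, CircleMaps.winding θC γ = c (loopClass ℤ ℤ (1 : ℤ) γ) := by
    intro γ
    obtain ⟨G, hG, hθγ, hdeg⟩ := hθ γ
    refine CircleMaps.winding_eq_of_lift θC γ (G := fun t => 2 * Real.pi * G t) (by fun_prop)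
      (fun t => ?_) _ ?_
    · change Circle.exp (2 * Real.pi * G t) = toCircle (θ (γ t))
      rw [hθγ t]
      exact (toCircle_circlePt (G t)).symm
    · rw [← hφ, ← mul_sub, hdeg]
      ring
  refine ⟨θC, ?_, fun γ k hk => ?_⟩
  · rw [hwind, hc1]
  · rw [hwind, hk, map_zsmul, hc1, smul_eq_mul, mul_one]

end CircleMap

/-! ### Restriction to the knot complement -/

section KnotRestriction

variable {K : Knot}
variable (hemb : IsEmbedding ((Metric.closedBall (0 : EuclideanSpace ℝ (Fin 2)) 1 ×ˢ
  (univ : Set (EuclideanSpace ℝ (Fin 2)))).restrict F))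
variable (hnorm : ∀ x w : EuclideanSpace ℝ (Fin 2),
  ‖x‖ ≤ 1 → ‖F (x, w)‖ ≤ 1 ∧ (‖F (x, w)‖ = 1 ↔ ‖x‖ = 1))
variable (hK : ∀ x : Metric.sphere (0 : EuclideanSpace ℝ (Fin 2)) 1, F (x, 0) = K x)
include hemb hnorm hK

/-- Along the restriction to `S³ ∖ K` of a circle-valued map on `ℝ⁴ ∖ P`, the meridian of `K` winds as
the plane meridian does. [folklore] -/
theorem winding_comp_complToPlaneCompl_meridian (θ : C(↥(mvU F), Circle))
    (x₀ : Metric.sphere (0 : EuclideanSpace ℝ (Fin 2)) 1) (r : ℝ) (hr : 0 < r) :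
    CircleMaps.winding (θ.comp (complToPlaneCompl hnorm hK)) (meridian hemb hnorm hK x₀ r hr) =
      CircleMaps.winding θ (planeMeridian hemb hnorm x₀ r hr) := by
  refine CircleMaps.winding_congr _ _ _ _ fun t => ?_
  change θ (complToPlaneCompl hnorm hK (meridian hemb hnorm hK x₀ r hr t)) =
    θ (planeMeridian hemb hnorm x₀ r hr t)
  congr 1
  apply Subtype.ext
  change F (↑x₀, PlaneComplex.ofC (windingLoop r hr 1 t)) =
    radialExt F (↑x₀, PlaneComplex.ofC (windingLoop r hr 1 t))
  rw [radialExt_apply_sphere]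

/-- **A circle-valued map on the flat-disc exterior `ℝ⁴ ∖ P` whose restriction to `S³ ∖ K` winds once
along the meridian and zero times along the longitude of the flat tube** — the circle map of the
disc exterior extending the (homotopy class of the) Seifert circle map of the knot (Livingston 2005,
§2, proof of Thm. 2.6; §6 for the locally flat category). Its restriction `θ ∘ ι` therefore satisfies
the winding hypotheses of the flat tube (`ker_windingHom_eq_commutator`,
`exists_mulEquiv_inv_windingHom` of `FlatDiscMeridianLongitude.lean`) and `θ` those of the plane
complement (`ker_windingHom_eq_commutator_planeCompl`). [cite: Livingston2005, §2 Thm. 2.6] -/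
theorem exists_circleMap_winding_meridian_longitude
    (x₀ : Metric.sphere (0 : EuclideanSpace ℝ (Fin 2)) 1) (r : ℝ) (hr : 0 < r) :
    ∃ θ : C(↥(mvU F), Circle),
      CircleMaps.winding θ (planeMeridian hemb hnorm x₀ r hr) = 1 ∧
      CircleMaps.winding (θ.comp (complToPlaneCompl hnorm hK)) (meridian hemb hnorm hK x₀ r hr) = 1 ∧
      ∀ (w : EuclideanSpace ℝ (Fin 2)) (hw : w ≠ 0),
        CircleMaps.winding (θ.comp (complToPlaneCompl hnorm hK)) (longitude hemb hnorm hK w hw) = 0 := by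
  obtain ⟨θ, hθ, -⟩ := exists_circleMap_winding_planeMeridian hemb hnorm (x₀ : EuclideanSpace ℝ (Fin 2)) r hr
  exact ⟨θ, hθ, (winding_comp_complToPlaneCompl_meridian hemb hnorm hK θ x₀ r hr).trans hθ,
    fun w hw => winding_longitude hemb hnorm hK _ w hw⟩

end KnotRestriction

end TopFlatDisc

end Literature.Topology.FourManifolds

end
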